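import Summits.BirchSwinnertonDyer.BirchSwinnertonDyer.Theorems.PrintCFramBottomClassIndexLawFiveLeSelmerDevissageCountRational
import Summits.BirchSwinnertonDyer.BirchSwinnertonDyer.Theorems.PrintCFramBottomClassIndexLawFiveLeSelmerDevissageDichotomy
import Summits.BirchSwinnertonDyer.BirchSwinnertonDyer.Theorems.PrintCFramBottomClassIndexLawFiveLeParitySplit
import HarnessLib

/-!
# Route `PrintCFram`, crux C2 `BottomClassIndexLawFiveLe` (stmt-BirchSwinnertonDyer-20372), line
# `eisenstein-resource-bdp-line` (registry v19, stub B1 `stub_bsdp_of_classFactor`): **THE SELMER COUNT OVER `ℚ`, ALIGNED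
# AND TRANSVERSE** — one side relaxed at `p`, the dichotomy on `Sel_p(W/ℚ)`, and the glue with the parity split
# (cell `bsd-print-cfram`, width seat `bsd-line-cfram-p1-w2` g9; helper `--supports` 20372; 0 defs, 0 facts, 0 sorry)

HONEST FRAMING. Nothing about BSD is proved unconditionally here and no stub is closed. Sequel of
`…SelmerDevissageCountRational` (the both-strict count `#Sel_p(W/ℚ) ≤ p · #R_str(W[p]/Φ) · #R_str(Φ)`), same notation:
`Γ = Γ_ℚ`, `M = W[p]`, `Φ ≤ M` a stable line, `v` the place above `p`, `D_p = decomp v`, `S_p = {v' ∣ p}`,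
`R_rel(A) = h1Unramified A S_p` (coboundary on every `I_𝔓`, `𝔓 ∤ p`), `R_str(A) = R_rel(A) ⊓ ker res_{D_p}`.
LEAD g10's anatomy (report §2 (a)–(b)): the classes of `Sel_p(W/ℚ)` restrict at `p` into ONE line `L_p = W(ℚ_p)/p`
(`W(ℚ_p)[p] = 0`); `W` is ALIGNED when `L_p` lies in the image of `H¹(ℚ_p, Φ)` — then every `π_* c`, `c ∈ Sel_p`, is a
coboundary on `D_p` — and TRANSVERSE when `L_p` meets it trivially — then every `w : Γ → Φ` with `[Φ.incl ∘ w] ∈ Sel_p` is a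
coboundary on `D_p`; of the pair `{W, W/Φ}` exactly one is aligned.

* §1 **`natCard_selmerGroup_le_of_aligned`** — ALIGNED ⟹ `#Sel_p(W/ℚ) ≤ #R_str(Φ.Quot) · #R_rel(Φ.Sub)`;
  **`natCard_selmerGroup_le_of_transverse`** — TRANSVERSE ⟹ `#Sel_p(W/ℚ) ≤ #R_rel(Φ.Quot) · #R_str(Φ.Sub)` (both from
  `SelmerCount.natCard_le_of_devissage` with the families `{I_𝔓 : 𝔓 ∤ p} ∪ {D_p}` / `{I_𝔓 : 𝔓 ∤ p}`; hypotheses only at the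
  BAD `v' ∤ p`: `W(ℚ_{v'})[p] = 0`, `Φ.Quot^{I_𝔓} = 0`); **`aligned_or_transverse_selmerGroup`** — `W(ℚ_p)[p] = 0` and
  `Φ.Quot^{D_p} = 0` ⟹ ALIGNED ∨ TRANSVERSE (`SelmerCount.aligned_or_transverse` with `#Sel_p ≤ p · #(Sel_p ∩ ker res_{D_p})`,
  Bhargava–Skinner's count `natCard_selmerGroup_le_prime_mul_of_natCard_torsion_eq_one`).
  In dimensions (`u_• = dim_𝔽_p R_•`): ALIGNED `dim Sel_p ≤ u_str(θ_Q) + u_rel(θ_S)`, TRANSVERSE `≤ u_rel(θ_Q) + u_str(θ_S)`;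
  with the class-group side (w7 g3: `u_str(ψ) = v_p(B_{1,ψ⁻¹})`-cyclicity by Mazur–Wiles, `u_rel(θ_e) ≤ u_str(ψ)` by the
  Kummer reflection count, `u_rel(ψ) ≤ 1 + u_str(θ_e)`): CASE S (`W_ψ` transverse ⟺ `W_e` aligned) ∧ `u(ψ) ≤ 1` ⟹
  `#Sel_p ≤ p²` for BOTH models; CASE R needs `u(θ_e) = 0` (then the both-strict count already gives `p²`).
* §2 THE GLUE WITH THE PARITY SPLIT (w2 g8 `ParitySplit.bsdp_of_natCard_selmerGroup_le_sq`: Cassels–Tate `hCT`, GZK, `r_an = 1`,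
  `p ∤ #Ш_an(W)`, `#Sel_p ≤ p²` ⟹ `BSD_p`): **`bsdp_of_strict_counts`**, **`bsdp_of_transverse_counts`**,
  **`bsdp_of_aligned_counts`** — `BSD(W,p)` from the residual-group bounds (quotient factor, sub factor with product `≤ p²`,
  resp. `= 1`/`≤ p` in the strict form) and B1-an's datum `padicValRat p (#Ш_an) = 0`. This is the kernel form of «on
  CASE S ∧ u(ψ) = 1, B1 ⟺ p ∤ #Ш_an(W)» (LEAD g11 22:11:05Z (1)), pending only the class-side counts.

THEOREMS ONLY; no definition, no named fact, no `sorry`. BSD is not proved by any of this; no summit statement is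
proved by this seat. References: [SilvermanAEC2009] X.§4 (Cor. 4.4, Ex. 4.8); [BhargavaSkinner2014] proof of Lemma 16;
[GreenbergLNM1716] §3; [Cassels1962ArithmeticIV]; [Miller2011LMS] Def. 1.1; the LEAD g10 report §2, seat notes w2g8 §4.
-/

set_option autoImplicit false
-- `…BirchSwinnertonDyer.BirchSwinnertonDyer.Theorems…` is the problem's mandated namespace (D-0017).
set_option linter.dupNamespace false

noncomputable section

open scoped Classical

namespace Summit.BirchSwinnertonDyer.BirchSwinnertonDyer.Theorems.PrintCFram.SelmerCount

open NumberField IsDedekindDomain Field WeierstrassCurve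
open Literature.NumberTheory.EllipticCurves Literature.NumberTheory.GaloisRepresentations
  Literature.NumberTheory.EllipticCurves.GreenbergSelmer
  Literature.NumberTheory.EllipticCurves.Rank1Residual
open Summit.BirchSwinnertonDyer.BirchSwinnertonDyer.Theorems.PrintCFram.LevelDictionary
open Summit.BirchSwinnertonDyer.Rank1Residual.X2.ResidualDevissageModules

universe u

variable (W : WeierstrassCurve ℚ) [W.IsElliptic]

/-! ## §1 One side relaxed at `p`: the ALIGNED and the TRANSVERSE count, and the dichotomy -/

section Aligned

/-- **ALIGNED ⟹ `#Sel_p(W/ℚ) ≤ #R_str(Φ.Quot) · #R_rel(Φ.Sub)`.** `W/ℚ` elliptic, `p` prime, `v` the place above `p`,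
`Φ ≤ W[p]` a stable subgroup; at every BAD `v' ∤ p` assume `W(ℚ_{v'})[p] = 0` and `Φ.Quot^{I_𝔓} = 0` (`𝔓 ∣ v'`). If `W` is
ALIGNED at `p` along `Φ` — every push-forward `Φ.proj ∘ z` of a Selmer cocycle `z` is a coboundary on `D_p` — then the quotient
side is STRICT and the sub side RELAXED: `#Sel_p(W/ℚ) ≤ #(h1Unramified Φ.Quot S_p ⊓ ker res_{D_p}) · #(h1Unramified Φ.Sub S_p)`.
[cite: SilvermanAEC2009, X.§4 (Cor. 4.4, Ex. 4.8)] [cite: GreenbergLNM1716, §3 (PDF p. 86)] -/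
theorem natCard_selmerGroup_le_of_aligned {p : ℕ} [hp : Fact p.Prime] (v : HeightOneSpectrum (𝓞 ℚ))
    (Φ : StableSubgroup (absoluteGaloisGroup ℚ) (geomTorsion W (p : ℤ)))
    (hbad : ∀ v' : HeightOneSpectrum (𝓞 ℚ), ¬ W.HasGoodReductionAt v' → ((p : ℕ) : 𝓞 ℚ) ∉ v'.asIdeal →
      ∀ P : (W.baseChange (v'.adicCompletion ℚ)).toAffine.Point, p • P = 0 → P = 0)
    (hQI : ∀ v' : HeightOneSpectrum (𝓞 ℚ), ¬ W.HasGoodReductionAt v' → ((p : ℕ) : 𝓞 ℚ) ∉ v'.asIdeal →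
      ∀ 𝔓 ∈ v'.primesAbove, ∀ q : Φ.Quot,
        (∀ g ∈ 𝔓.inertia (absoluteGaloisGroup ℚ), g • q = q) → q = 0)
    (hAL : ∀ z : contOneCocycles (discreteTopRep (absoluteGaloisGroup ℚ) (geomTorsion W (p : ℤ))),
      oneCocycleClass _ z ∈ selmerGroup W (p : ℤ) →
        ∃ q : Φ.Quot, ∀ g ∈ decomp v, Φ.proj (z.1 g) = g • q - q) :
    Nat.card (selmerGroup W (p : ℤ)) ≤
      Nat.card ↥(h1Unramified Φ.Quot {v' : HeightOneSpectrum (𝓞 ℚ) | ((p : ℕ) : 𝓞 ℚ) ∈ v'.asIdeal} ⊓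
          subgroupResKer Φ.Quot (decomp v)) *
        Nat.card ↥(h1Unramified Φ.Sub {v' : HeightOneSpectrum (𝓞 ℚ) | ((p : ℕ) : 𝓞 ℚ) ∈ v'.asIdeal}) := by
  have hp0 : ((p : ℕ) : ℤ) ≠ 0 := by exact_mod_cast hp.out.ne_zero
  set Γ := absoluteGaloisGroup ℚ
  set M := geomTorsion W (p : ℤ) with hM
  set Sp : Set (HeightOneSpectrum (𝓞 ℚ)) := {v' | ((p : ℕ) : 𝓞 ℚ) ∈ v'.asIdeal} with hSp
  set 𝓘S : Set (Subgroup Γ) := {I | ∃ (v' : HeightOneSpectrum (𝓞 ℚ)) (𝔓 : Ideal (absIntegers (𝓞 ℚ) ℚ)),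
      v' ∉ Sp ∧ 𝔓 ∈ v'.primesAbove ∧ I = 𝔓.inertia Γ} with h𝓘S
  set 𝓘Q : Set (Subgroup Γ) := {I | I = decomp v ∨ ∃ (v' : HeightOneSpectrum (𝓞 ℚ))
      (𝔓 : Ideal (absIntegers (𝓞 ℚ) ℚ)), v' ∉ Sp ∧ 𝔓 ∈ v'.primesAbove ∧ I = 𝔓.inertia Γ} with h𝓘Q
  have hcont : ∀ m : M, Continuous fun g : Γ ↦ g • m := continuous_smul_geomTorsion W (p : ℤ)
  have hι : ∀ (g : Γ) (s : Φ.Sub), Φ.incl (g • s) = g • Φ.incl s := fun _ _ ↦ rfl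
  have hπ : ∀ (g : Γ) (x : M), Φ.proj (g • x) = g • Φ.proj x := fun _ _ ↦ rfl
  have hπι : ∀ s : Φ.Sub, Φ.proj (Φ.incl s) = 0 := fun s ↦ (QuotientAddGroup.eq_zero_iff _).mpr s.2
  have hker : ∀ x : M, Φ.proj x = 0 → ∃ s : Φ.Sub, Φ.incl s = x := fun x hx ↦
    ⟨⟨x, (QuotientAddGroup.eq_zero_iff x).mp hx⟩, rfl⟩
  -- Selmer classes are coboundaries on `I_𝔓`, `𝔓 ∤ p`
  have hSelI : ∀ c ∈ selmerGroup W (p : ℤ), ∀ (v' : HeightOneSpectrum (𝓞 ℚ))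
      (𝔓 : Ideal (absIntegers (𝓞 ℚ) ℚ)), v' ∉ Sp → 𝔓 ∈ v'.primesAbove →
        c ∈ subgroupResKer M (𝔓.inertia Γ) := by
    intro c hc v' 𝔓 hv' h𝔓
    by_cases hgood : W.HasGoodReductionAt v'
    · exact mem_subgroupResKer_inertia_of_mem_selmerGroup W hc hv' (Or.inl hgood) h𝔓
    · exact mem_subgroupResKer_inertia_of_mem_selmerGroup W hc hv' (Or.inr (hbad v' hgood hv')) h𝔓
  have hQ𝓘 : ∀ (v' : HeightOneSpectrum (𝓞 ℚ)) (𝔓 : Ideal (absIntegers (𝓞 ℚ) ℚ)), v' ∉ Sp →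
      𝔓 ∈ v'.primesAbove → (∀ q : Φ.Quot, (∀ g ∈ 𝔓.inertia Γ, g • q = q) → q = 0) ∨
        (∀ g ∈ 𝔓.inertia Γ, ∀ x : M, g • x = x) := by
    intro v' 𝔓 hv' h𝔓
    by_cases hgood : W.HasGoodReductionAt v'
    · exact Or.inr fun g hg x ↦ W.smul_geomTorsion_eq_of_mem_inertia hgood
        (n := (p : ℤ)) (by exact_mod_cast hv') h𝔓 hg x
    · exact Or.inl (hQI v' hgood hv' 𝔓 h𝔓)
  -- finiteness of the targets
  haveI : Finite M := finite_torsionPoints_holds W (AlgebraicClosure ℚ) hp0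
  haveI : Finite Φ.Sub := Finite.of_injective _ Φ.incl_injective
  haveI : Finite Φ.Quot := Finite.of_surjective _ Φ.proj_surjective
  have hSpfin : Sp.Finite := by
    convert finite_setOf_intCast_mem_asIdeal (K := ℚ) hp0 using 1
    ext v'
    simp only [hSp, Set.mem_setOf_eq, Int.cast_natCast]
  haveI hfQ : Finite ↥(h1Unramified Φ.Quot Sp) :=
    finite_h1Unramified_of_continuous Φ.Quot (Φ.continuous_smul_quot hcont) hSpfin
  haveI hfS : Finite ↥(h1Unramified Φ.Sub Sp) :=
    finite_h1Unramified_of_continuous Φ.Sub (Φ.continuous_smul_sub hcont) hSpfin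
  have hleQ := iInf_subgroupResKer_le_h1Unramified_inf Φ.Quot Sp (decomp v)
  have hleS := iInf_subgroupResKer_le_h1Unramified Φ.Sub Sp
  haveI : Finite ↥(h1Unramified Φ.Quot Sp ⊓ subgroupResKer Φ.Quot (decomp v)) :=
    Finite.of_injective _ (AddSubgroup.inclusion_injective inf_le_left)
  have hfinQ : Finite ↥(⨅ I ∈ 𝓘Q, subgroupResKer Φ.Quot I) :=
    Finite.of_injective _ (AddSubgroup.inclusion_injective hleQ)
  have hfinS : Finite ↥(⨅ I ∈ 𝓘S, subgroupResKer Φ.Sub I) :=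
    Finite.of_injective _ (AddSubgroup.inclusion_injective hleS)
  -- the dévissage count with `𝓘Q = {D_p} ∪ {I_𝔓}`, `𝓘S = {I_𝔓}`
  have h := natCard_le_of_devissage hcont Φ.incl Φ.proj hι hπ Φ.incl_injective Φ.proj_surjective hπι hker
    (selmerGroup W (p : ℤ)) 𝓘Q 𝓘S ?_ ?_ hfinQ hfinS
  · exact h.trans (Nat.mul_le_mul (AddSubgroup.card_le_of_le hleQ) (AddSubgroup.card_le_of_le hleS))
  · -- quotient side: `D_p` by ALIGNED, inertia by transfer
    rintro z hz I (rfl | ⟨v', 𝔓, hv', h𝔓, rfl⟩)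
    · exact hAL z hz
    · obtain ⟨x, hx⟩ := (oneCocycleClass_mem_subgroupResKer_iff _ z).1 (hSelI _ hz v' 𝔓 hv' h𝔓)
      exact ⟨Φ.proj x, fun g hg ↦ by rw [hx ⟨g, hg⟩, map_sub, hπ]⟩
  · -- sub side: inertia by transfer (no condition at `D_p`)
    rintro w hw I ⟨v', 𝔓, hv', h𝔓, rfl⟩
    obtain ⟨x, hx⟩ := (oneCocycleClass_mem_subgroupResKer_iff _ _).1 (hSelI _ hw v' 𝔓 hv' h𝔓)
    exact coboundaryOn_of_incl_coboundaryOn Φ.incl Φ.proj hι hπ Φ.incl_injective hπι hker _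
      (hQ𝓘 v' 𝔓 hv' h𝔓) w.1 (v := x) fun g hg ↦ hx ⟨g, hg⟩

/-- **TRANSVERSE ⟹ `#Sel_p(W/ℚ) ≤ #R_rel(Φ.Quot) · #R_str(Φ.Sub)`.** Same setting; if `W` is TRANSVERSE at `p` along `Φ` —
every continuous crossed homomorphism `w : Γ_ℚ → Φ` whose push-forward `Φ.incl ∘ w` has a Selmer class is a coboundary on
`D_p` — then the sub side is STRICT and the quotient side RELAXED:
`#Sel_p(W/ℚ) ≤ #(h1Unramified Φ.Quot S_p) · #(h1Unramified Φ.Sub S_p ⊓ ker res_{D_p})`.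
[cite: SilvermanAEC2009, X.§4 (Cor. 4.4, Ex. 4.8)] [cite: GreenbergLNM1716, §3 (PDF p. 86)] -/
theorem natCard_selmerGroup_le_of_transverse {p : ℕ} [hp : Fact p.Prime] (v : HeightOneSpectrum (𝓞 ℚ))
    (Φ : StableSubgroup (absoluteGaloisGroup ℚ) (geomTorsion W (p : ℤ)))
    (hbad : ∀ v' : HeightOneSpectrum (𝓞 ℚ), ¬ W.HasGoodReductionAt v' → ((p : ℕ) : 𝓞 ℚ) ∉ v'.asIdeal →
      ∀ P : (W.baseChange (v'.adicCompletion ℚ)).toAffine.Point, p • P = 0 → P = 0)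
    (hQI : ∀ v' : HeightOneSpectrum (𝓞 ℚ), ¬ W.HasGoodReductionAt v' → ((p : ℕ) : 𝓞 ℚ) ∉ v'.asIdeal →
      ∀ 𝔓 ∈ v'.primesAbove, ∀ q : Φ.Quot,
        (∀ g ∈ 𝔓.inertia (absoluteGaloisGroup ℚ), g • q = q) → q = 0)
    (hTR : ∀ w : contOneCocycles (discreteTopRep (absoluteGaloisGroup ℚ) Φ.Sub),
      oneCocycleClass (discreteTopRep (absoluteGaloisGroup ℚ) (geomTorsion W (p : ℤ)))
        (contOneCocycles.pullback (ContinuousMonoidHom.id _)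
          (resHomOfEquivariant (ContinuousMonoidHom.id _) Φ.incl Φ.incl_smul) w) ∈ selmerGroup W (p : ℤ) →
        ∃ s : Φ.Sub, ∀ g ∈ decomp v, w.1 g = g • s - s) :
    Nat.card (selmerGroup W (p : ℤ)) ≤
      Nat.card ↥(h1Unramified Φ.Quot {v' : HeightOneSpectrum (𝓞 ℚ) | ((p : ℕ) : 𝓞 ℚ) ∈ v'.asIdeal}) *
        Nat.card ↥(h1Unramified Φ.Sub {v' : HeightOneSpectrum (𝓞 ℚ) | ((p : ℕ) : 𝓞 ℚ) ∈ v'.asIdeal} ⊓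
          subgroupResKer Φ.Sub (decomp v)) := by
  have hp0 : ((p : ℕ) : ℤ) ≠ 0 := by exact_mod_cast hp.out.ne_zero
  set Γ := absoluteGaloisGroup ℚ
  set M := geomTorsion W (p : ℤ) with hM
  set Sp : Set (HeightOneSpectrum (𝓞 ℚ)) := {v' | ((p : ℕ) : 𝓞 ℚ) ∈ v'.asIdeal} with hSp
  set 𝓘Q : Set (Subgroup Γ) := {I | ∃ (v' : HeightOneSpectrum (𝓞 ℚ)) (𝔓 : Ideal (absIntegers (𝓞 ℚ) ℚ)),
      v' ∉ Sp ∧ 𝔓 ∈ v'.primesAbove ∧ I = 𝔓.inertia Γ} with h𝓘Q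
  set 𝓘S : Set (Subgroup Γ) := {I | I = decomp v ∨ ∃ (v' : HeightOneSpectrum (𝓞 ℚ))
      (𝔓 : Ideal (absIntegers (𝓞 ℚ) ℚ)), v' ∉ Sp ∧ 𝔓 ∈ v'.primesAbove ∧ I = 𝔓.inertia Γ} with h𝓘S
  have hcont : ∀ m : M, Continuous fun g : Γ ↦ g • m := continuous_smul_geomTorsion W (p : ℤ)
  have hι : ∀ (g : Γ) (s : Φ.Sub), Φ.incl (g • s) = g • Φ.incl s := fun _ _ ↦ rfl
  have hπ : ∀ (g : Γ) (x : M), Φ.proj (g • x) = g • Φ.proj x := fun _ _ ↦ rfl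
  have hπι : ∀ s : Φ.Sub, Φ.proj (Φ.incl s) = 0 := fun s ↦ (QuotientAddGroup.eq_zero_iff _).mpr s.2
  have hker : ∀ x : M, Φ.proj x = 0 → ∃ s : Φ.Sub, Φ.incl s = x := fun x hx ↦
    ⟨⟨x, (QuotientAddGroup.eq_zero_iff x).mp hx⟩, rfl⟩
  have hSelI : ∀ c ∈ selmerGroup W (p : ℤ), ∀ (v' : HeightOneSpectrum (𝓞 ℚ))
      (𝔓 : Ideal (absIntegers (𝓞 ℚ) ℚ)), v' ∉ Sp → 𝔓 ∈ v'.primesAbove →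
        c ∈ subgroupResKer M (𝔓.inertia Γ) := by
    intro c hc v' 𝔓 hv' h𝔓
    by_cases hgood : W.HasGoodReductionAt v'
    · exact mem_subgroupResKer_inertia_of_mem_selmerGroup W hc hv' (Or.inl hgood) h𝔓
    · exact mem_subgroupResKer_inertia_of_mem_selmerGroup W hc hv' (Or.inr (hbad v' hgood hv')) h𝔓
  have hQ𝓘 : ∀ (v' : HeightOneSpectrum (𝓞 ℚ)) (𝔓 : Ideal (absIntegers (𝓞 ℚ) ℚ)), v' ∉ Sp →
      𝔓 ∈ v'.primesAbove → (∀ q : Φ.Quot, (∀ g ∈ 𝔓.inertia Γ, g • q = q) → q = 0) ∨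
        (∀ g ∈ 𝔓.inertia Γ, ∀ x : M, g • x = x) := by
    intro v' 𝔓 hv' h𝔓
    by_cases hgood : W.HasGoodReductionAt v'
    · exact Or.inr fun g hg x ↦ W.smul_geomTorsion_eq_of_mem_inertia hgood
        (n := (p : ℤ)) (by exact_mod_cast hv') h𝔓 hg x
    · exact Or.inl (hQI v' hgood hv' 𝔓 h𝔓)
  haveI : Finite M := finite_torsionPoints_holds W (AlgebraicClosure ℚ) hp0
  haveI : Finite Φ.Sub := Finite.of_injective _ Φ.incl_injective
  haveI : Finite Φ.Quot := Finite.of_surjective _ Φ.proj_surjective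
  have hSpfin : Sp.Finite := by
    convert finite_setOf_intCast_mem_asIdeal (K := ℚ) hp0 using 1
    ext v'
    simp only [hSp, Set.mem_setOf_eq, Int.cast_natCast]
  haveI hfQ : Finite ↥(h1Unramified Φ.Quot Sp) :=
    finite_h1Unramified_of_continuous Φ.Quot (Φ.continuous_smul_quot hcont) hSpfin
  haveI hfS : Finite ↥(h1Unramified Φ.Sub Sp) :=
    finite_h1Unramified_of_continuous Φ.Sub (Φ.continuous_smul_sub hcont) hSpfin
  have hleQ := iInf_subgroupResKer_le_h1Unramified Φ.Quot Sp
  have hleS := iInf_subgroupResKer_le_h1Unramified_inf Φ.Sub Sp (decomp v)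
  haveI : Finite ↥(h1Unramified Φ.Sub Sp ⊓ subgroupResKer Φ.Sub (decomp v)) :=
    Finite.of_injective _ (AddSubgroup.inclusion_injective inf_le_left)
  have hfinQ : Finite ↥(⨅ I ∈ 𝓘Q, subgroupResKer Φ.Quot I) :=
    Finite.of_injective _ (AddSubgroup.inclusion_injective hleQ)
  have hfinS : Finite ↥(⨅ I ∈ 𝓘S, subgroupResKer Φ.Sub I) :=
    Finite.of_injective _ (AddSubgroup.inclusion_injective hleS)
  have h := natCard_le_of_devissage hcont Φ.incl Φ.proj hι hπ Φ.incl_injective Φ.proj_surjective hπι hker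
    (selmerGroup W (p : ℤ)) 𝓘Q 𝓘S ?_ ?_ hfinQ hfinS
  · exact h.trans (Nat.mul_le_mul (AddSubgroup.card_le_of_le hleQ) (AddSubgroup.card_le_of_le hleS))
  · -- quotient side: inertia by transfer (no condition at `D_p`)
    rintro z hz I ⟨v', 𝔓, hv', h𝔓, rfl⟩
    obtain ⟨x, hx⟩ := (oneCocycleClass_mem_subgroupResKer_iff _ z).1 (hSelI _ hz v' 𝔓 hv' h𝔓)
    exact ⟨Φ.proj x, fun g hg ↦ by rw [hx ⟨g, hg⟩, map_sub, hπ]⟩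
  · -- sub side: `D_p` by TRANSVERSE, inertia by transfer
    rintro w hw I (rfl | ⟨v', 𝔓, hv', h𝔓, rfl⟩)
    · exact hTR w hw
    · obtain ⟨x, hx⟩ := (oneCocycleClass_mem_subgroupResKer_iff _ _).1 (hSelI _ hw v' 𝔓 hv' h𝔓)
      exact coboundaryOn_of_incl_coboundaryOn Φ.incl Φ.proj hι hπ Φ.incl_injective hπι hker _
        (hQ𝓘 v' 𝔓 hv' h𝔓) w.1 (v := x) fun g hg ↦ hx ⟨g, hg⟩

/-- **ALIGNED OR TRANSVERSE for `Sel_p(W/ℚ)`** («two lines in a plane», LEAD g10 report §2(a)). If `W(ℚ_p)[p] = 0` (so the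
local Kummer condition at `p` is ONE line: `#Sel_p ≤ p · #Z_p`, Bhargava–Skinner's count) and `Φ.Quot^{D_p} = 0`, then `W`
is ALIGNED or TRANSVERSE at `p` along `Φ` (`SelmerCount.aligned_or_transverse`).
[cite: BhargavaSkinner2014, proof of Lemma 16] [cite: SerreGaloisCohomology1997, I.§2.6 (b) and I.§5.1] -/
theorem aligned_or_transverse_selmerGroup {p : ℕ} [hp : Fact p.Prime]
    {v : HeightOneSpectrum (𝓞 ℚ)} (hpv : ((p : ℕ) : 𝓞 ℚ) ∈ v.asIdeal)
    (htors : Nat.card (nsmulAddMonoidHom p :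
      (W.baseChange (v.adicCompletion ℚ)).toAffine.Point →+ _).ker = 1)
    (Φ : StableSubgroup (absoluteGaloisGroup ℚ) (geomTorsion W (p : ℤ)))
    (hQD : ∀ q : Φ.Quot, (∀ g ∈ decomp v, g • q = q) → q = 0) :
    (∀ z : contOneCocycles (discreteTopRep (absoluteGaloisGroup ℚ) (geomTorsion W (p : ℤ))),
        oneCocycleClass _ z ∈ selmerGroup W (p : ℤ) →
          ∃ q : Φ.Quot, ∀ g ∈ decomp v, Φ.proj (z.1 g) = g • q - q) ∨
      ∀ w : contOneCocycles (discreteTopRep (absoluteGaloisGroup ℚ) Φ.Sub),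
        oneCocycleClass (discreteTopRep (absoluteGaloisGroup ℚ) (geomTorsion W (p : ℤ)))
          (contOneCocycles.pullback (ContinuousMonoidHom.id _)
            (resHomOfEquivariant (ContinuousMonoidHom.id _) Φ.incl Φ.incl_smul) w) ∈ selmerGroup W (p : ℤ) →
          ∃ s : Φ.Sub, ∀ g ∈ decomp v, w.1 g = g • s - s := by
  have hp0 : ((p : ℕ) : ℤ) ≠ 0 := by exact_mod_cast hp.out.ne_zero
  haveI : Finite (selmerGroup W (p : ℤ)) := W.finite_selmerGroup_holds hp0
  have hπ : ∀ (g : absoluteGaloisGroup ℚ) (x : geomTorsion W (p : ℤ)), Φ.proj (g • x) = g • Φ.proj x :=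
    fun _ _ ↦ rfl
  have hπι : ∀ s : Φ.Sub, Φ.proj (Φ.incl s) = 0 := fun s ↦ (QuotientAddGroup.eq_zero_iff _).mpr s.2
  have hker : ∀ x : geomTorsion W (p : ℤ), Φ.proj x = 0 → ∃ s : Φ.Sub, Φ.incl s = x := fun x hx ↦
    ⟨⟨x, (QuotientAddGroup.eq_zero_iff x).mp hx⟩, rfl⟩
  have hpM : ∀ m : geomTorsion W (p : ℤ), p • m = 0 := fun m ↦ Subtype.ext (by
    rw [AddSubmonoidClass.coe_nsmul, ZeroMemClass.coe_zero, ← natCast_zsmul]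
    exact (mem_geomTorsion_iff W (p : ℤ) m.1).mp m.2)
  have hline : Nat.card (selmerGroup W (p : ℤ)) ≤
      p * Nat.card ↥(selmerGroup W (p : ℤ) ⊓ subgroupResKer (geomTorsion W (p : ℤ)) (decomp v)) :=
    (W.natCard_selmerGroup_le_prime_mul_of_natCard_torsion_eq_one hpv htors).trans
      (Nat.mul_le_mul_left p (natCard_selmerResKer_le W v))
  exact aligned_or_transverse Φ.incl Φ.proj Φ.incl_smul hπ Φ.incl_injective hπι hker hpM (decomp v) hQD
    (selmerGroup W (p : ℤ)) hline

end Aligned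

/-! ## §2 The glue with the parity split: `BSD(W,p)` from the residual-group counts and `p ∤ #Ш_an(W)` -/

section Glue

open Literature.NumberTheory.EllipticCurves.KrizLi2019

/-- **`BSD(W,p)` from the both-strict counts.** In analytic rank one, granting Cassels–Tate (`hCT`) and GZK: if
`#Ш_an(W)` is a rational `p`-adic unit, `W(ℚ_p)[p] = 0`, the class-side local inputs hold, `#R_str(Φ.Quot) = 1` and
`#R_str(Φ.Sub) ≤ p`, then `BSD(W,p)` (`…Rational.natCard_selmerGroup_le_sq_of_strict` + w2 g8's
`ParitySplit.bsdp_of_natCard_selmerGroup_le_sq`). [cite: Cassels1962ArithmeticIV] [cite: Miller2011LMS, Def. 1.1] -/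
theorem bsdp_of_strict_counts {p : ℕ} [hp : Fact p.Prime]
    (hCT : exists_casselsTate_pairing (K := ℚ)) (hGZK : rank_eq_analyticRank_of_analyticRank_le_one)
    (hr : W.analyticRank = 1) {q : ℚ} (hq : shaAn W = (q : ℂ)) (hvq : padicValRat p q = 0)
    {v : HeightOneSpectrum (𝓞 ℚ)} (hpv : ((p : ℕ) : 𝓞 ℚ) ∈ v.asIdeal)
    (htors : Nat.card (nsmulAddMonoidHom p :
      (W.baseChange (v.adicCompletion ℚ)).toAffine.Point →+ _).ker = 1)
    (Φ : StableSubgroup (absoluteGaloisGroup ℚ) (geomTorsion W (p : ℤ)))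
    (hQD : ∀ q : Φ.Quot, (∀ g ∈ decomp v, g • q = q) → q = 0)
    (hbad : ∀ v' : HeightOneSpectrum (𝓞 ℚ), ¬ W.HasGoodReductionAt v' → ((p : ℕ) : 𝓞 ℚ) ∉ v'.asIdeal →
      ∀ P : (W.baseChange (v'.adicCompletion ℚ)).toAffine.Point, p • P = 0 → P = 0)
    (hQI : ∀ v' : HeightOneSpectrum (𝓞 ℚ), ¬ W.HasGoodReductionAt v' → ((p : ℕ) : 𝓞 ℚ) ∉ v'.asIdeal →
      ∀ 𝔓 ∈ v'.primesAbove, ∀ q : Φ.Quot,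
        (∀ g ∈ 𝔓.inertia (absoluteGaloisGroup ℚ), g • q = q) → q = 0)
    (huQ : Nat.card ↥(h1Unramified Φ.Quot {v' : HeightOneSpectrum (𝓞 ℚ) | ((p : ℕ) : 𝓞 ℚ) ∈ v'.asIdeal} ⊓
      subgroupResKer Φ.Quot (decomp v)) = 1)
    (huS : Nat.card ↥(h1Unramified Φ.Sub {v' : HeightOneSpectrum (𝓞 ℚ) | ((p : ℕ) : 𝓞 ℚ) ∈ v'.asIdeal} ⊓
      subgroupResKer Φ.Sub (decomp v)) ≤ p) :
    BSDp W p :=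
  ParitySplit.bsdp_of_natCard_selmerGroup_le_sq W p hCT hGZK hr hq hvq
    (natCard_selmerGroup_le_sq_of_strict W hpv htors Φ hQD hbad hQI huQ huS)

/-- **`BSD(W,p)` in the TRANSVERSE case.** In analytic rank one, granting `hCT` and GZK: if `#Ш_an(W)` is a rational
`p`-adic unit, the class-side local inputs hold at the bad `v' ∤ p`, `W` is TRANSVERSE at `p` along `Φ`, and
`#R_rel(Φ.Quot) · #R_str(Φ.Sub) ≤ p²` (CASE S of the CM-ramified pair with `u(ψ) ≤ 1`: `u_rel(θ_e) ≤ u(ψ) ≤ 1`,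
`u_str(ψ) ≤ 1`), then `BSD(W,p)`. [cite: Cassels1962ArithmeticIV] [cite: Miller2011LMS, Def. 1.1] -/
theorem bsdp_of_transverse_counts {p : ℕ} [hp : Fact p.Prime]
    (hCT : exists_casselsTate_pairing (K := ℚ)) (hGZK : rank_eq_analyticRank_of_analyticRank_le_one)
    (hr : W.analyticRank = 1) {q : ℚ} (hq : shaAn W = (q : ℂ)) (hvq : padicValRat p q = 0)
    (v : HeightOneSpectrum (𝓞 ℚ))
    (Φ : StableSubgroup (absoluteGaloisGroup ℚ) (geomTorsion W (p : ℤ)))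
    (hbad : ∀ v' : HeightOneSpectrum (𝓞 ℚ), ¬ W.HasGoodReductionAt v' → ((p : ℕ) : 𝓞 ℚ) ∉ v'.asIdeal →
      ∀ P : (W.baseChange (v'.adicCompletion ℚ)).toAffine.Point, p • P = 0 → P = 0)
    (hQI : ∀ v' : HeightOneSpectrum (𝓞 ℚ), ¬ W.HasGoodReductionAt v' → ((p : ℕ) : 𝓞 ℚ) ∉ v'.asIdeal →
      ∀ 𝔓 ∈ v'.primesAbove, ∀ q : Φ.Quot,
        (∀ g ∈ 𝔓.inertia (absoluteGaloisGroup ℚ), g • q = q) → q = 0)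
    (hTR : ∀ w : contOneCocycles (discreteTopRep (absoluteGaloisGroup ℚ) Φ.Sub),
      oneCocycleClass (discreteTopRep (absoluteGaloisGroup ℚ) (geomTorsion W (p : ℤ)))
        (contOneCocycles.pullback (ContinuousMonoidHom.id _)
          (resHomOfEquivariant (ContinuousMonoidHom.id _) Φ.incl Φ.incl_smul) w) ∈ selmerGroup W (p : ℤ) →
        ∃ s : Φ.Sub, ∀ g ∈ decomp v, w.1 g = g • s - s)
    (hprod : Nat.card ↥(h1Unramified Φ.Quot {v' : HeightOneSpectrum (𝓞 ℚ) | ((p : ℕ) : 𝓞 ℚ) ∈ v'.asIdeal}) *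
        Nat.card ↥(h1Unramified Φ.Sub {v' : HeightOneSpectrum (𝓞 ℚ) | ((p : ℕ) : 𝓞 ℚ) ∈ v'.asIdeal} ⊓
          subgroupResKer Φ.Sub (decomp v)) ≤ p ^ 2) :
    BSDp W p :=
  ParitySplit.bsdp_of_natCard_selmerGroup_le_sq W p hCT hGZK hr hq hvq
    ((natCard_selmerGroup_le_of_transverse W v Φ hbad hQI hTR).trans hprod)

/-- **`BSD(W,p)` in the ALIGNED case.** In analytic rank one, granting `hCT` and GZK: if `#Ш_an(W)` is a rational
`p`-adic unit, the class-side local inputs hold at the bad `v' ∤ p`, `W` is ALIGNED at `p` along `Φ`, and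
`#R_str(Φ.Quot) · #R_rel(Φ.Sub) ≤ p²` (the partner of a transverse member: the same two numbers, `u_str(ψ) ≤ 1`,
`u_rel(θ_e) ≤ 1`), then `BSD(W,p)`. [cite: Cassels1962ArithmeticIV] [cite: Miller2011LMS, Def. 1.1] -/
theorem bsdp_of_aligned_counts {p : ℕ} [hp : Fact p.Prime]
    (hCT : exists_casselsTate_pairing (K := ℚ)) (hGZK : rank_eq_analyticRank_of_analyticRank_le_one)
    (hr : W.analyticRank = 1) {q : ℚ} (hq : shaAn W = (q : ℂ)) (hvq : padicValRat p q = 0)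
    (v : HeightOneSpectrum (𝓞 ℚ))
    (Φ : StableSubgroup (absoluteGaloisGroup ℚ) (geomTorsion W (p : ℤ)))
    (hbad : ∀ v' : HeightOneSpectrum (𝓞 ℚ), ¬ W.HasGoodReductionAt v' → ((p : ℕ) : 𝓞 ℚ) ∉ v'.asIdeal →
      ∀ P : (W.baseChange (v'.adicCompletion ℚ)).toAffine.Point, p • P = 0 → P = 0)
    (hQI : ∀ v' : HeightOneSpectrum (𝓞 ℚ), ¬ W.HasGoodReductionAt v' → ((p : ℕ) : 𝓞 ℚ) ∉ v'.asIdeal →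
      ∀ 𝔓 ∈ v'.primesAbove, ∀ q : Φ.Quot,
        (∀ g ∈ 𝔓.inertia (absoluteGaloisGroup ℚ), g • q = q) → q = 0)
    (hAL : ∀ z : contOneCocycles (discreteTopRep (absoluteGaloisGroup ℚ) (geomTorsion W (p : ℤ))),
      oneCocycleClass _ z ∈ selmerGroup W (p : ℤ) →
        ∃ q : Φ.Quot, ∀ g ∈ decomp v, Φ.proj (z.1 g) = g • q - q)
    (hprod : Nat.card ↥(h1Unramified Φ.Quot {v' : HeightOneSpectrum (𝓞 ℚ) | ((p : ℕ) : 𝓞 ℚ) ∈ v'.asIdeal} ⊓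
          subgroupResKer Φ.Quot (decomp v)) *
        Nat.card ↥(h1Unramified Φ.Sub {v' : HeightOneSpectrum (𝓞 ℚ) | ((p : ℕ) : 𝓞 ℚ) ∈ v'.asIdeal}) ≤ p ^ 2) :
    BSDp W p :=
  ParitySplit.bsdp_of_natCard_selmerGroup_le_sq W p hCT hGZK hr hq hvq
    ((natCard_selmerGroup_le_of_aligned W v Φ hbad hQI hAL).trans hprod)

end Glue

end Summit.BirchSwinnertonDyer.BirchSwinnertonDyer.Theorems.PrintCFram.SelmerCount

end
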